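import Summits.CriticalPhenomena.CardyFormulaZ2.Theses.CardyMaterialLaw

/-!
# Crux `AutonomousLaw` (stmt-CriticalPhenomena-11171) — birth skeleton (`Lines/birth.lean`)

Route `CardyMaterialLaw` (sub-problem `CardyFormulaZ2`), crux
`Summit.CriticalPhenomena.CardyFormulaZ2.Theses.CardyMaterialLaw.AutonomousLaw` (card K1, AUT):
along every mesh sequence `u → 0⁺` there is ONE law `L : ℂ → ℂ → (Fin 3 → ℂ)`, `L s 0 = 0`, such that
for every 3-marked Jordan domain `T` with an equilateral Carleson datum `(a, b, c, ψ)` of orientation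
`s = triangleTurn a b c`, every locally uniform limit `G` of the bond-`ℤ²` separating triple
`(H^{u_n}_α)_α` on `T` and every interior point `z` where `G` is differentiable, the defect triple
`w = (∂̄G_α(z))_α` satisfies `w = L s (Σ_α s^{2α} w_α)`.

## The line (`birth`): `ℤ₃`-Fourier decomposition of the defect triple

For a primitive cube root of unity `s` (`s² + s + 1 = 0`, tree lemma
`triangleTurn_sq_add_self_add_one`) a triple `w ∈ ℂ³` is recovered from its three `ℤ₃`-Fourier
modes `m_k = Σ_α s^{kα} w_α` by `w_β = (m₀ + s^{2β} m₁ + s^{β} m₂)/3`. The law's argument is the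
STRAIN mode `m₂ = Σ s^{2α} w_α`; so `AutonomousLaw` is exactly the statement that the two other
modes are functions of `(s, m₂)` along a mesh sequence — the card's reading "AUT ⟺ two universal
pointwise relations among `∇g⁰, ∇g¹, ∇g²` beyond `∇Σgⁱ = 0`" (card cr-material-law, K1). The
skeleton cuts the crux along these two relations:

* `stub_sumAsymptConst` (mode `m₀`, the colour-blind relation `∇Σ_α G_α = 0`, stated at FINITE
  mesh, pointwise and boundary-robust): for every 3-marked domain `T` and interior points `z, w`,
  `Σ_α H^δ_α(z) − Σ_α H^δ_α(w) → 0` as `δ → 0⁺` — the separating triple is asymptotically a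
  partition of a constant (in the Cardy world `Σ_α h_α ≡ 1`, Bollobás–Riordan Claim 24; here
  neither the value of the constant nor any boundary behaviour of the naive discretisation is
  asserted). [L/open: no direct percolation proof of `Σ H_α → const` is in print for `ℤ²`.]
* `stub_defectModeLaw` (mode `m₁`, the chiral relation): along each mesh sequence the DEFECT mode
  `Σ_α s^{α} ∂̄G_α(z)` is an autonomous function `ℓ s` of the strain mode, `ℓ s 0 = 0`, on the
  crux's own frame (in the Cardy world `ℓ ≡ 0`: `∂̄h_α ∝ s^α` gives `Σ s^{2α}·s^α·c = 0`). This is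
  the load-bearing stub: one complex (two real) closure relation instead of the crux's `ℂ³`-valued
  law. [open-problem strength, as the crux.]

`AutonomousLaw_of` composes them WITHOUT `sorry`: (i) limit passage — `stub_sumAsymptConst` along
`u_n` and the locally uniform convergence give `Σ_α G_α(x) = Σ_α G_α(z)` on `T.carrier`;
(ii) calculus — `T.carrier` is open, so the complexified sum is locally constant at `z`, its Fréchet
derivative vanishes (`HasFDerivAt.fun_sum` + uniqueness), whence `Σ_α ∂̄G_α(z) = 0`
(`sum_dbarAlong_eq_zero`); (iii) algebra — with `L s σ β = 3⁻¹ (s^β σ + s^{2β} ℓ s σ)` the law is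
`ℤ₃`-Fourier inversion modulo `s² + s + 1 = 0` (`fourier_inversion_fin3`), and `L s 0 = 0` from
`ℓ s 0 = 0`.

Disproof used: none on file for this crux (`ledger crux ls stmt-CriticalPhenomena-11171`: no
`Disproof.lean`, no `Negative/` lemmas, no workfiles at registration, 2026-08-17).
-/

noncomputable section

namespace Summit.CriticalPhenomena.CardyFormulaZ2.Cruxes.AutonomousLaw.Birth

open Filter Topology Complex
open Literature.Analysis.Complex Literature.Probability.Percolation

/-! ### Stub signatures (named, so that the composition's hypotheses are the stubs BY NAME) -/

/-- Signature of `stub_sumAsymptConst` (Stub 1, mode `m₀`): for every 3-marked Jordan domain `T`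
and interior points `z, w ∈ Ω`, the sums of the three bond-`ℤ²` separating probabilities at `z` and
at `w` are asymptotically equal as the mesh tends to `0⁺`:
`Σ_α H^δ_α(z) − Σ_α H^δ_α(w) → 0`. The finite-mesh, two-point form of "the separating triple is a
partition of a constant in the scaling limit" (Cardy world: `Σ_α h_α ≡ 1`, Bollobás–Riordan 2006
Ch. 7 Claim 24; Smirnov 2001 §2); it pins neither the constant nor any boundary behaviour of the
naive discretisation `discreteDomainGraph`/`nearestSite`. Why plausibly true / where it may fail:
true in the Cardy world and forced by the interior relation (36) alone (`∂̄G_{α+1} = s ∂̄G_α ⇒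
Σ ∂̄G_α = 0`); no lattice argument giving it directly on `ℤ²` is known. -/
def Sig.stub_sumAsymptConst : Prop :=
    ∀ (T : Literature.Probability.RandomPlanarGeometry.MarkedDomain 3), ∀ z ∈ T.carrier, ∀ w ∈ T.carrier,
      Filter.Tendsto
        (fun δ : ℝ => (∑ α : Fin 3, Literature.Probability.Percolation.bondSeparatingProb T α δ z) -
          ∑ α : Fin 3, Literature.Probability.Percolation.bondSeparatingProb T α δ w)
        (nhdsWithin 0 (Set.Ioi 0)) (nhds 0)

/-- Signature of `stub_defectModeLaw` (Stub 2, mode `m₁`, load-bearing): along every mesh sequence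
`u → 0⁺` there is ONE scalar law `ℓ : ℂ → ℂ → ℂ` with `ℓ s 0 = 0` such that, on the crux's frame
(3-marked Jordan domain `T`, equilateral Carleson datum `(a, b, c, ψ)` of orientation
`s = triangleTurn a b c`, locally uniform limit `G` of `(H^{u_n}_α)_α` on `T`, interior point `z`
where `G` is differentiable), the DEFECT Fourier mode of the antiholomorphic gradients is a function
of the STRAIN mode: `Σ_α s^{α} ∂̄G_α(z) = ℓ s (Σ_α s^{2α} ∂̄G_α(z))`. Cardy world: `ℓ ≡ 0`
(`∂̄h_α = conj(ψ′) s^α/3` gives `Σ_α s^{2α} ∂̄h_α = 0`). Why it might fail: as the crux — outside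
the conformally invariant world nothing known forces a pointwise closure of the chiral mode across
all domains (three arc patterns, three free amplitude fields; card numerics fit 19–31% of the
finite-mesh defect by any material law). -/
def Sig.stub_defectModeLaw : Prop :=
    ∀ u : ℕ → ℝ, (∀ n, 0 < u n) → Filter.Tendsto u Filter.atTop (nhds 0) →
      ∃ ℓ : ℂ → ℂ → ℂ, (∀ s, ℓ s 0 = 0) ∧
        ∀ (T : Literature.Probability.RandomPlanarGeometry.MarkedDomain 3) (a b c : ℂ)
          (ψ : Literature.Probability.RandomPlanarGeometry.ConformalEquiv T.carrier
            (Literature.Probability.Percolation.openTriangle a b c)),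
          Literature.Probability.Percolation.IsEquilateral a b c → ψ.HasBoundaryValue (T.pt 0) a →
          ψ.HasBoundaryValue (T.pt 1) b → ψ.HasBoundaryValue (T.pt 2) c →
          ∀ G : Fin 3 → ℂ → ℝ,
            (∀ α : Fin 3, TendstoLocallyUniformlyOn
              (fun (n : ℕ) (z : ℂ) => Literature.Probability.Percolation.bondSeparatingProb T α (u n) z)
              (G α) Filter.atTop T.carrier) →
            ∀ z ∈ T.carrier, (∀ α, DifferentiableAt ℝ (G α) z) →
              ∑ α : Fin 3, Literature.Probability.Percolation.triangleTurn a b c ^ (α : ℕ) *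
                  Literature.Analysis.Complex.dbarAlong (1 : ℂ) (fun w : ℂ => (G α w : ℂ)) z =
                ℓ (Literature.Probability.Percolation.triangleTurn a b c)
                  (∑ α : Fin 3, Literature.Probability.Percolation.triangleTurn a b c ^ (2 * (α : ℕ)) *
                    Literature.Analysis.Complex.dbarAlong (1 : ℂ) (fun w : ℂ => (G α w : ℂ)) z)

/-! ### The stubs -/

/-- **Stub 1** (mode `m₀`): the bond-`ℤ²` separating triple sums to an asymptotically constant
function of the interior point (see `Sig.stub_sumAsymptConst`). -/
theorem stub_sumAsymptConst : Sig.stub_sumAsymptConst := by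
  sorry

/-- **Stub 2** (mode `m₁`, load-bearing): the defect Fourier mode obeys a scalar autonomous law in
the strain mode along each mesh sequence (see `Sig.stub_defectModeLaw`). -/
theorem stub_defectModeLaw : Sig.stub_defectModeLaw := by
  sorry

/-! ### Sorry-free glue: calculus and `ℤ₃`-Fourier inversion -/

/-- **Calculus step.** If real functions `G₀, G₁, G₂` on an open set `U` have constant sum on `U`
and are real-differentiable at `z ∈ U`, then the `∂̄`-derivatives of their complexifications sum
to zero at `z`. -/
theorem sum_dbarAlong_eq_zero {U : Set ℂ} (hU : IsOpen U) {G : Fin 3 → ℂ → ℝ} {z : ℂ}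
    (hz : z ∈ U) (hconst : ∀ x ∈ U, ∑ α : Fin 3, G α x = ∑ α : Fin 3, G α z)
    (hdiff : ∀ α, DifferentiableAt ℝ (G α) z) :
    ∑ α : Fin 3, dbarAlong (1 : ℂ) (fun x : ℂ => (G α x : ℂ)) z = 0 := by
  -- each complexified component is differentiable, with derivative `ofRealCLM ∘ D(G α)(z)`
  have hF : ∀ α : Fin 3, HasFDerivAt (fun x : ℂ => (G α x : ℂ))
      (ofRealCLM.comp (fderiv ℝ (G α) z)) z :=
    fun α => ofRealCLM.hasFDerivAt.comp z (hdiff α).hasFDerivAt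
  -- the complexified sum is locally constant at `z`, hence has derivative `0`
  have hS : HasFDerivAt (fun x : ℂ => ∑ α : Fin 3, (G α x : ℂ))
      (∑ α : Fin 3, ofRealCLM.comp (fderiv ℝ (G α) z)) z :=
    HasFDerivAt.fun_sum fun α _ => hF α
  have hev : (fun x : ℂ => ∑ α : Fin 3, (G α x : ℂ)) =ᶠ[𝓝 z] fun _ => ∑ α : Fin 3, (G α z : ℂ) := by
    filter_upwards [hU.mem_nhds hz] with x hx
    exact_mod_cast hconst x hx
  have hC : HasFDerivAt (fun x : ℂ => ∑ α : Fin 3, (G α x : ℂ)) (0 : ℂ →L[ℝ] ℂ) z :=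
    (hasFDerivAt_const _ z).congr_of_eventuallyEq hev
  have h0 : (∑ α : Fin 3, ofRealCLM.comp (fderiv ℝ (G α) z)) = 0 := hS.unique hC
  have hD : ∑ α : Fin 3, fderiv ℝ (fun x : ℂ => (G α x : ℂ)) z = 0 := by
    rw [← h0]
    exact Finset.sum_congr rfl fun α _ => (hF α).fderiv
  have e : ∀ v : ℂ, ∑ α : Fin 3, fderiv ℝ (fun x : ℂ => (G α x : ℂ)) z v = 0 := fun v => by
    rw [← sum_apply, hD]
    rfl
  simp only [dbarAlong_apply, smul_add, Finset.sum_add_distrib, ← Finset.smul_sum, e, smul_zero,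
    add_zero]

/-- **Algebra step (`ℤ₃`-Fourier inversion).** For `s` with `s² + s + 1 = 0` and a triple `w` with
vanishing trivial mode `Σ w_α = 0` and defect mode `Σ s^α w_α = ℓ s (Σ s^{2α} w_α)`, the triple is
the explicit function `β ↦ (s^β σ + s^{2β} ℓ s σ)/3` of the strain mode `σ = Σ s^{2α} w_α`. -/
theorem fourier_inversion_fin3 {s : ℂ} (hs : s ^ 2 + s + 1 = 0) {w : Fin 3 → ℂ} {ℓ : ℂ → ℂ → ℂ}
    (hm0 : ∑ α : Fin 3, w α = 0)
    (hm1 : ∑ α : Fin 3, s ^ (α : ℕ) * w α = ℓ s (∑ α : Fin 3, s ^ (2 * (α : ℕ)) * w α)) :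
    w = fun β : Fin 3 => (3 : ℂ)⁻¹ * (s ^ (β : ℕ) * (∑ α : Fin 3, s ^ (2 * (α : ℕ)) * w α) +
      s ^ (2 * (β : ℕ)) * ℓ s (∑ α : Fin 3, s ^ (2 * (α : ℕ)) * w α)) := by
  rw [← hm1]
  simp only [Fin.sum_univ_three, Fin.val_zero, Fin.val_one, Fin.val_two] at hm0 ⊢
  funext β
  fin_cases β
  · simp only [Fin.reduceFinMk, Fin.isValue]
    linear_combination (3 : ℂ)⁻¹ * hm0 - (3 : ℂ)⁻¹ * w 1 * hs - (3 : ℂ)⁻¹ * (s ^ 2 - s + 1) * w 2 * hs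
  · simp only [Fin.reduceFinMk, Fin.isValue]
    linear_combination (3 : ℂ)⁻¹ * hm0 - (3 : ℂ)⁻¹ * w 0 * hs - (3 : ℂ)⁻¹ * 2 * (s - 1) * w 1 * hs -
      (3 : ℂ)⁻¹ * (s ^ 3 - s + 1) * w 2 * hs
  · simp only [Fin.reduceFinMk, Fin.isValue]
    linear_combination (3 : ℂ)⁻¹ * hm0 - (3 : ℂ)⁻¹ * (s ^ 2 - s + 1) * w 0 * hs -
      (3 : ℂ)⁻¹ * (s ^ 3 - s + 1) * w 1 * hs - (3 : ℂ)⁻¹ * 2 * (s - 1) * (s ^ 3 + 1) * w 2 * hs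

/-- **Limit step.** Along a mesh sequence `u_n → 0⁺`, Stub 1 and the locally uniform convergence
`H^{u_n}_α → G_α` on `T.carrier` give a limit triple with constant sum on `T.carrier`. -/
theorem sum_limit_const (h1 : Sig.stub_sumAsymptConst)
    {T : Literature.Probability.RandomPlanarGeometry.MarkedDomain 3} {u : ℕ → ℝ} {G : Fin 3 → ℂ → ℝ}
    (hu_pos : ∀ n, 0 < u n) (hu : Tendsto u atTop (𝓝 0))
    (hG : ∀ α : Fin 3, TendstoLocallyUniformlyOn
      (fun (n : ℕ) (z : ℂ) => bondSeparatingProb T α (u n) z) (G α) atTop T.carrier)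
    {z : ℂ} (hz : z ∈ T.carrier) {x : ℂ} (hx : x ∈ T.carrier) :
    ∑ α : Fin 3, G α x = ∑ α : Fin 3, G α z := by
  have hu' : Tendsto u atTop (𝓝[>] (0 : ℝ)) :=
    tendsto_nhdsWithin_iff.2 ⟨hu, Eventually.of_forall fun n => (hu_pos n : u n ∈ Set.Ioi (0 : ℝ))⟩
  -- pointwise convergence of the sums at `x` and at `z`
  have hpt : ∀ y ∈ T.carrier, Tendsto (fun n => ∑ α : Fin 3, bondSeparatingProb T α (u n) y) atTop
      (𝓝 (∑ α : Fin 3, G α y)) := fun y hy =>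
    tendsto_finsetSum _ fun α _ => (hG α).tendsto_at hy
  have hdiff : Tendsto (fun n => (∑ α : Fin 3, bondSeparatingProb T α (u n) x) -
      ∑ α : Fin 3, bondSeparatingProb T α (u n) z) atTop (𝓝 ((∑ α : Fin 3, G α x) - ∑ α : Fin 3, G α z)) :=
    (hpt x hx).sub (hpt z hz)
  have hzero : Tendsto (fun n => (∑ α : Fin 3, bondSeparatingProb T α (u n) x) -
      ∑ α : Fin 3, bondSeparatingProb T α (u n) z) atTop (𝓝 0) :=
    (h1 T x hx z hz).comp hu'
  exact sub_eq_zero.1 (tendsto_nhds_unique hdiff hzero)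

/-! ### The composition (sorry-free): the two stubs give the crux BY NAME -/

/-- **The composition (kernel-checked, no `sorry`): Stub 1 and Stub 2 imply the crux
`CardyMaterialLaw.AutonomousLaw` BY NAME.** Given the scalar law `ℓ` of Stub 2 along `u`, take
`L s σ β = 3⁻¹ (s^β σ + s^{2β} ℓ s σ)` (so `L s 0 = 0`); at a configuration `(T, a, b, c, ψ, G, z)`
Stub 1 gives `Σ_α G_α` constant on `T.carrier` (`sum_limit_const`), hence `Σ_α ∂̄G_α(z) = 0`
(`sum_dbarAlong_eq_zero`, `T.carrier` open), and `ℤ₃`-Fourier inversion with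
`s² + s + 1 = 0` (`triangleTurn_sq_add_self_add_one`) is the law (`fourier_inversion_fin3`). -/
theorem AutonomousLaw_of :
    Sig.stub_sumAsymptConst → Sig.stub_defectModeLaw →
    Summit.CriticalPhenomena.CardyFormulaZ2.Theses.CardyMaterialLaw.AutonomousLaw := by
  intro h1 h2 u hu_pos hu
  obtain ⟨ℓ, hℓ0, hℓ⟩ := h2 u hu_pos hu
  refine ⟨fun s σ β => (3 : ℂ)⁻¹ * (s ^ (β : ℕ) * σ + s ^ (2 * (β : ℕ)) * ℓ s σ), ?_, ?_⟩
  · intro s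
    funext β
    simp [hℓ0]
  · intro T a b c ψ habc ha hb hc G hG z hz hdz
    have hm0 : ∑ α : Fin 3, dbarAlong (1 : ℂ) (fun x : ℂ => (G α x : ℂ)) z = 0 :=
      sum_dbarAlong_eq_zero T.isOpen hz (fun x hx => sum_limit_const h1 hu_pos hu hG hz hx) hdz
    have hm1 := hℓ T a b c ψ habc ha hb hc G hG z hz hdz
    exact fourier_inversion_fin3 (triangleTurn_sq_add_self_add_one habc) hm0 hm1

end Summit.CriticalPhenomena.CardyFormulaZ2.Cruxes.AutonomousLaw.Birth

end
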